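import Summits.QuantumFields.BalabanUV.Beta.E3CoDressedContact

/-!
# `BalabanUV.Beta.E3ContactGenerator` — binder row D1, RULING R-D1-g28-2 FILE E2a: THE BORDER-READING CONTACT GENERATOR `ctGenM B` AND ITS
# `ℋ`-DRESSED FORM (the generator of record for the (0.4) literal's (Sr-conj) letters: multiplier leg reads the spread's own border `B = bhK + Dsh`;
# at the rooted border `bhKAt ρ_c` it IS an2's `ctGen`)

HONEST FRAMING (cell charter, verbatim): «discharging BetaPertH makes Balaban's UV stability UNCONDITIONAL — a real constructive-QFT result; it is
NOT the continuum limit and NOT the Clay problem.»  HONEST DEPENDENCY: continuum YM on T⁴ ⇐ BetaPertH ∧ nine spine estimates (0/9 proved); BetaPertH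
⇐ (D1) ∧ (D4) ∧ CAP+tail; G-an2-4 gates asym, D1 and NE2/3/4.  DERIVED cell leaf (β sub-cell, BINDER-OWNERS row D1 OWNER `b2b-balaban-beta-an2`, gen 28).
WHY (RULING R-D1-g28-2 (M), journal [AN2-G28-RULING2]): in the (Sr-conj) induction the dressed generator's MULTIPLIER leg is read by the rule
`(𝕄_j ∘ G_j)_mm = 1_coarse` against the multiplier–field BORDER OF THE SPREAD ITSELF; for the comb that border is `bhKAt ρ_c`'s rooted `q¹` and the
generator is an2's `ctGen`; for the (0.4) literal the spread of record is the shifted `bhKStepSh Dsh j` (R-D1-g28-1) with border `bhK + Dsh`, so the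
generator must read `bhK + Dsh` — an3-g55's `ctGen⁰⁴ = ctGen[linKerAt ↦ lin⁰⁴KerAt ρ_c]` once `Dsh` is an1's.  This file makes the border a PARAMETER.
WHAT ([folklore] over OUR objects; one [our object] definition asserting nothing): §1 **`ctGenM B α L κ′ u`** (field leg `−[x = u ∧ β = κ′ ∧ κ′ = α]`
verbatim, multiplier leg `(z, μ) ↦ −[μ = α]·L^{−(d+1)}·B z u (inr μ) (inl κ′)`), `ctGenM_bhKAt : ctGenM (bhKAt d ρ_c L) = ctGen d`, the bound
`abs_ctGenM_le`, bi-localisation `biLoc_diagK_ctGenM` (rate `δ/2`), `locStencil_diagK_ctGenM`, `summable_colH_mul_ctGenM`; §2 the `ℋ`-dressed generator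
`Gᵛ = Σ_κ Σ'_u colH K L μ y κ u · ctGenM B α L κ u`: `diagK_dressedGenM_eq_vertexOfK`, `loc_diagK_dressedGenM`, `vertexOfK_conjV_smul_diagK_ctGenM`
(pattern: `E3CoDressedContact` §2, an3 gen 30, with `ctGen ↦ ctGenM B`).
HONEST: discharges NOTHING of the row; root-level classes 0∕5; tables 0∕5; NOT D1, NOT `BetaPertH`, NOT continuum, NOT Clay.  No statement of Bałaban's
papers, no `[cite:]`, no `Prop` fact.  Provenance: β sub-cell, unit beta-an2 gen 28, 2026-08-21 (v1); no existing file touched.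
-/

noncomputable section

open Finset
open scoped BigOperators
open Literature.Probability.LatticeModels (Torus.proj)
open Literature.MathematicalPhysics.QuantumFieldTheory
open Literature.MathematicalPhysics.QuantumFieldTheory.Balaban1983to89
open Literature.MathematicalPhysics.QuantumFieldTheory.Balaban1983to89.Beta
open B12Sec2to5 (l1 l1_nonneg)
open ExpKernelCalculus (MKer comp Decays BiLoc VertexFamily summable_exp_shift')
open OneStepResolventKernel (Fib LocStencil)
open OneStepKernelFamily (colH vertexOfK vertexFamily_vertexOfK' abs_colH_le)
open AveragingContoursRooted (ctr ctrOff ctrOff_mem_box)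
open Summit.QuantumFields.BalabanUV.Beta.TameKernelCalculus
open Summit.QuantumFields.BalabanUV.Beta.ChartConjugation (conjV)
open Summit.QuantumFields.BalabanUV.Beta.BorderedHessian (bhKAt bhKAt_inr_inl diagK diagK_apply conjV_diagK_apply ctGen ctGen_inl ctGen_inr
  linAvgAt_delta1_eq_pow_mul_linKerAt)
open Summit.QuantumFields.BalabanUV.Beta.VertexReflectionContact (smul_diagK vertexOfK_conjV_diagK)

namespace Summit.QuantumFields.BalabanUV.Beta.E3ContactGenerator

variable {d : ℕ}

/-! ## §1 The border-reading contact generator `ctGenM B` -/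

section Gen

variable (d)

open Classical in
/-- [our object — a generator asserting nothing] **THE PRODUCT-CHART CONTACT GENERATOR READING THE BORDER `B`** at the jet bond `(κ′, u)` for the
reflection of axis `α`: field leg `(x, β) ↦ −[x = u ∧ β = κ′ ∧ κ′ = α]` (same-bond letter), multiplier leg `(z, μ) ↦ −[μ = α]·L^{−(d+1)}·B z u (inr μ) (inl κ′)`
(the `B`-border column of the jet bond, on the reflected coarse axis).  `B = bhKAt d ρ_c L` gives `ctGen`; `B = bhK L + Dsh` is the literal's. -/
def ctGenM (B : MKer (d + 1) (Fib d)) (α : Fin (d + 1)) (L : ℕ) (κ' : Fin (d + 1)) (u : Fin (d + 1) → ℤ) :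
    (Fin (d + 1) → ℤ) → Fib d → ℝ :=
  fun x a =>
    match a with
    | Sum.inl β => if x = u ∧ β = κ' ∧ κ' = α then -1 else 0
    | Sum.inr μ => if μ = α then -(((L : ℝ) ^ (d + 1))⁻¹ * B x u (Sum.inr μ) (Sum.inl κ')) else 0

variable {d} (B : MKer (d + 1) (Fib d)) (α : Fin (d + 1)) (L : ℕ) (κ' : Fin (d + 1)) (u : Fin (d + 1) → ℤ)

open Classical in
/-- [folklore] Field leg. -/
theorem ctGenM_inl (x : Fin (d + 1) → ℤ) (β : Fin (d + 1)) :
    ctGenM d B α L κ' u x (Sum.inl β) = if x = u ∧ β = κ' ∧ κ' = α then -1 else 0 := rfl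

open Classical in
/-- [folklore] Multiplier leg. -/
theorem ctGenM_inr (z : Fin (d + 1) → ℤ) (μ : Fin (d + 1)) :
    ctGenM d B α L κ' u z (Sum.inr μ) = if μ = α then -(((L : ℝ) ^ (d + 1))⁻¹ * B z u (Sum.inr μ) (Sum.inl κ')) else 0 := rfl

/-- [folklore] **AT THE ROOTED BORDER THE GENERATOR IS an2's `ctGen`**: `ctGenM (bhKAt d ρ_c L) = ctGen d` (`bhKAt_inr_inl` + `linAvgAt = L^{d+1}·q¹`). -/
theorem ctGenM_bhKAt [NeZero L] : ctGenM d (bhKAt d (ctr (d + 1) L) L) α L κ' u = ctGen d α L κ' u := by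
  classical
  funext x a
  rcases a with β | μ
  · rw [ctGenM_inl, ctGen_inl]
  · rw [ctGenM_inr, ctGen_inr, bhKAt_inr_inl]
    have hL : ((L : ℝ) ^ (d + 1)) ≠ 0 := pow_ne_zero _ (by exact_mod_cast NeZero.ne L)
    by_cases hμ : μ = α
    · simp only [hμ, true_and, if_true]
      by_cases hx : Torus.proj L x = 0
      · rw [if_pos hx, if_pos ((BorderedHessian.off_eq_zero_iff_proj x).2 hx), linAvgAt_delta1_eq_pow_mul_linKerAt, ← mul_assoc,
          inv_mul_cancel₀ hL, one_mul]
        rfl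
      · rw [if_neg hx, if_neg (fun h => hx ((BorderedHessian.off_eq_zero_iff_proj x).1 h)), mul_zero, neg_zero]
    · rw [if_neg hμ, if_neg (fun h => hμ h.1)]

variable {B} {C δ : ℝ}

/-- [folklore] A decaying kernel is bounded by its constant. -/
theorem abs_le_of_decays (hB : Decays B C δ) (hδ : 0 ≤ δ) (x y : Fin (d + 1) → ℤ) (a b : Fib d) : |B x y a b| ≤ C := by
  have hC : 0 ≤ C := le_trans (abs_nonneg _) ((hB x x a a).trans (by rw [sub_self]; simp [l1]))
  refine (hB x y a b).trans ?_
  have : Real.exp (-δ * l1 (x - y)) ≤ 1 := Real.exp_le_one_iff.mpr (by nlinarith [l1_nonneg (x - y)])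
  nlinarith

/-- [folklore] The generator is bounded: `|ctGenM B α L κ′ u x a| ≤ 1 + L^{−(d+1)}·C`. -/
theorem abs_ctGenM_le (hB : Decays B C δ) (hδ : 0 ≤ δ) (x : Fin (d + 1) → ℤ) (a : Fib d) :
    |ctGenM d B α L κ' u x a| ≤ 1 + ((L : ℝ) ^ (d + 1))⁻¹ * C := by
  classical
  have hC : 0 ≤ C := le_trans (abs_nonneg _) (abs_le_of_decays hB hδ x x a a)
  have h2 : 0 ≤ ((L : ℝ) ^ (d + 1))⁻¹ * C := mul_nonneg (inv_nonneg.mpr (by positivity)) hC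
  rcases a with β | μ
  · rw [ctGenM_inl]
    split_ifs <;> simp <;> linarith
  · rw [ctGenM_inr]
    split_ifs
    · rw [abs_neg, abs_mul, abs_of_nonneg (inv_nonneg.mpr (by positivity))]
      exact le_add_of_nonneg_of_le zero_le_one (mul_le_mul_of_nonneg_left (abs_le_of_decays hB hδ _ _ _ _) (inv_nonneg.mpr (by positivity)))
    · simp; linarith

/-- [folklore] **THE GENERATOR'S DIAGONAL KERNEL IS BI-LOCALISED AT ITS JET BOND**: rate `δ/2`, constant `1 + L^{−(d+1)}·C`. -/
theorem biLoc_diagK_ctGenM (hB : Decays B C δ) (hδ : 0 ≤ δ) :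
    BiLoc (diagK (ctGenM d B α L κ' u)) u u (1 + ((L : ℝ) ^ (d + 1))⁻¹ * C) (δ / 2) := by
  classical
  have hC : 0 ≤ C := le_trans (abs_nonneg _) (abs_le_of_decays hB hδ u u (Sum.inl α) (Sum.inl α))
  have hK0 : 0 ≤ 1 + ((L : ℝ) ^ (d + 1))⁻¹ * C := add_nonneg zero_le_one (mul_nonneg (inv_nonneg.mpr (by positivity)) hC)
  intro x y a b
  rw [diagK_apply]
  split_ifs with h
  · obtain ⟨rfl, rfl⟩ := h
    rcases a with β | μ
    · rw [ctGenM_inl]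
      by_cases hx : x = u ∧ β = κ' ∧ κ' = α
      · rw [if_pos hx, hx.1, sub_self]
        simp only [l1, Pi.zero_apply, Int.cast_zero, abs_zero, Finset.sum_const_zero, add_zero, mul_zero, Real.exp_zero, mul_one, abs_neg, abs_one]
        linarith [mul_nonneg (inv_nonneg.mpr (show (0 : ℝ) ≤ (L : ℝ) ^ (d + 1) by positivity)) hC]
      · rw [if_neg hx, abs_zero]; positivity
    · rw [ctGenM_inr]
      by_cases hμ : μ = α
      · rw [if_pos hμ, abs_neg, abs_mul, abs_of_nonneg (inv_nonneg.mpr (by positivity))]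
        have hb := hB x u (Sum.inr μ) (Sum.inl κ')
        have he : Real.exp (-δ * l1 (x - u)) = Real.exp (-(δ / 2) * (l1 (x - u) + l1 (x - u))) := by congr 1; ring
        calc ((L : ℝ) ^ (d + 1))⁻¹ * |B x u (Sum.inr μ) (Sum.inl κ')| ≤ ((L : ℝ) ^ (d + 1))⁻¹ * (C * Real.exp (-δ * l1 (x - u))) :=
              mul_le_mul_of_nonneg_left hb (inv_nonneg.mpr (by positivity))
          _ = (((L : ℝ) ^ (d + 1))⁻¹ * C) * Real.exp (-(δ / 2) * (l1 (x - u) + l1 (x - u))) := by rw [he]; ring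
          _ ≤ (1 + ((L : ℝ) ^ (d + 1))⁻¹ * C) * Real.exp (-(δ / 2) * (l1 (x - u) + l1 (x - u))) :=
              mul_le_mul_of_nonneg_right (by linarith) (Real.exp_pos _).le
      · rw [if_neg hμ, abs_zero]; positivity
  · rw [abs_zero]; positivity

/-- [folklore] The generator family is a local stencil family (rate `δ/2`). -/
theorem locStencil_diagK_ctGenM (hB : Decays B C δ) (hδ : 0 ≤ δ) :
    LocStencil (fun κ u => diagK (ctGenM d B α L κ u)) (1 + ((L : ℝ) ^ (d + 1))⁻¹ * C) (δ / 2) :=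
  fun κ u => biLoc_diagK_ctGenM α L κ u hB hδ

/-- [folklore] **THE VERTEX WEIGHTS OF A DECAYING KERNEL AGAINST THE GENERATOR ARE SUMMABLE** (decaying × bounded). -/
theorem summable_colH_mul_ctGenM {N : ℕ} {K : MKer (d + 1) (Fib d)} (hK : ∃ δ C : ℝ, 0 < δ ∧ 0 ≤ C ∧ Decays K C δ) (hB : Decays B C δ)
    (hδ : 0 ≤ δ) (μ : Fin (d + 1)) (y : Fin (d + 1) → ℤ) (κ : Fin (d + 1)) (p : Fin (d + 1) → ℤ) (c : Fib d) :
    Summable fun u => colH K N μ y κ u * ctGenM d B α L κ u p c := by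
  obtain ⟨δK, CK, hδK, hCK, h⟩ := hK
  refine Summable.of_norm_bounded (((summable_exp_shift' hδK ((N : ℤ) • y)).mul_left CK).mul_right (1 + ((L : ℝ) ^ (d + 1))⁻¹ * C))
    (fun u => ?_)
  rw [Real.norm_eq_abs, abs_mul]
  exact mul_le_mul (abs_colH_le (N := N) h μ y κ u) (abs_ctGenM_le α L κ u hB hδ p c) (abs_nonneg _) (mul_nonneg hCK (Real.exp_pos _).le)

end Gen

/-! ## §2 The `ℋ`-dressed generator -/

section DressedGen

variable {Lc : ℕ} {B : MKer (d + 1) (Fib d)} (α : Fin (d + 1))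

/-- [folklore] `diagK Gᵛ = vertexOfK K Lc (κ u ↦ diagK (ctGenM d B α Lc κ u)) μ y` (entrywise). -/
theorem diagK_dressedGenM_eq_vertexOfK (K : MKer (d + 1) (Fib d)) (μ : Fin (d + 1)) (y : Fin (d + 1) → ℤ) :
    diagK (fun p c => ∑ κ, ∑' u, colH K Lc μ y κ u * ctGenM d B α Lc κ u p c) =
      vertexOfK K Lc (fun κ u => diagK (ctGenM d B α Lc κ u)) μ y := by
  classical
  funext x z a b
  simp only [vertexOfK, OneStepResolventKernel.wsum, diagK_apply]
  by_cases h : x = z ∧ a = b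
  · simp only [if_pos h]
  · simp only [if_neg h, mul_zero, tsum_zero, Finset.sum_const_zero]

/-- [folklore] **THE DIAGONAL KERNEL OF THE DRESSED GENERATOR IS LOCALISED** (spread `K`, spread border `B`). -/
theorem loc_diagK_dressedGenM {K : MKer (d + 1) (Fib d)} (hK : Spr K) (hB : Spr B) (μ : Fin (d + 1)) (y : Fin (d + 1) → ℤ) :
    Loc (diagK (fun p c => ∑ κ, ∑' u, colH K Lc μ y κ u * ctGenM d B α Lc κ u p c)) := by
  rw [diagK_dressedGenM_eq_vertexOfK]
  obtain ⟨δB, CB, hδB, -, hBd⟩ := E3GenericReflection.Spr.decays' hB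
  have hS := locStencil_diagK_ctGenM α Lc (B := B) hBd hδB.le
  obtain ⟨Cv, δv, hδv, hV⟩ := vertexFamily_vertexOfK' (N := Lc) (E3GenericReflection.Spr.decays' hK) hS (half_pos hδB)
  exact ⟨_, _, Cv, δv, hδv, hV μ y⟩

/-- [folklore] **THE CHAIN-RULE VERTEX OF THE SCALED DIAGONAL-CONTACT FAMILY IS THE SCALED DIAGONAL CONTACT OF THE DRESSED GENERATOR**. -/
theorem vertexOfK_conjV_smul_diagK_ctGenM {K : MKer (d + 1) (Fib d)} (hK : Spr K) (hB : Spr B) (𝕄' : MKer (d + 1) (Fib d)) (γ : ℝ)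
    (μ : Fin (d + 1)) (y : Fin (d + 1) → ℤ) :
    vertexOfK K Lc (fun κ u => conjV 𝕄' (γ • diagK (ctGenM d B α Lc κ u))) μ y =
      conjV 𝕄' (γ • diagK (fun p c => ∑ κ, ∑' u, colH K Lc μ y κ u * ctGenM d B α Lc κ u p c)) := by
  have hKd := E3GenericReflection.Spr.decays' hK
  obtain ⟨δB, CB, hδB, -, hBd⟩ := E3GenericReflection.Spr.decays' hB
  have hgs : ∀ (μ : Fin (d + 1)) (y : Fin (d + 1) → ℤ) (κ : Fin (d + 1)) (p : Fin (d + 1) → ℤ) (c : Fib d),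
      Summable fun u => colH K Lc μ y κ u * (γ * ctGenM d B α Lc κ u p c) :=
    fun μ y κ p c => ((summable_colH_mul_ctGenM α Lc hKd hBd hδB.le μ y κ p c).mul_left γ).congr fun u => by ring
  have hGen : (fun p c => ∑ κ, ∑' u, colH K Lc μ y κ u * (γ * ctGenM d B α Lc κ u p c))
      = fun p c => γ * ∑ κ, ∑' u, colH K Lc μ y κ u * ctGenM d B α Lc κ u p c := by
    funext p c
    rw [Finset.mul_sum]
    refine Finset.sum_congr rfl fun κ _ => ?_
    rw [← tsum_mul_left]
    exact tsum_congr fun u => by ring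
  have h1 : (fun κ u => conjV 𝕄' (γ • diagK (ctGenM d B α Lc κ u))) = fun κ u => conjV 𝕄' (diagK fun p c => γ * ctGenM d B α Lc κ u p c) := by
    funext κ u; rw [smul_diagK]
  rw [h1, vertexOfK_conjV_diagK _ _ Lc _ hgs μ y, hGen, smul_diagK]

end DressedGen

end Summit.QuantumFields.BalabanUV.Beta.E3ContactGenerator

end
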